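import Summits.BirchSwinnertonDyer.BirchSwinnertonDyer.Theorems.KimAtThreeDeepLowerDeepFamilyOfPinned
import Summits.BirchSwinnertonDyer.BirchSwinnertonDyer.Theorems.KimAtThreeShallowEqDeepUnlockedEnd
import Summits.BirchSwinnertonDyer.BirchSwinnertonDyer.Theorems.KimAtThreeDeepLowerOffStratumAdditiveDefectPortTwoExp
import HarnessLib

/-!
# Route `KimAtThreeKolyvagin` (rung W2), cruxes `DeepLowerAtThree` (19075) / `DeepLowerAtThreeOffKatoStratum`
# (19679): the LOWER row on EVERY tower row — local `3`-torsion allowed — from [S24] Thm. 4.4 (1)(2) AS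
# PRINTED + GZK + Poitou–Tate + ONE DEEP-guard unlocked port (the `t ≥ 1` rows' road WITHOUT the S24-DEEP flag)

Cell `bsd-addord`, seat `bsd-addord-w2-c2` (gen 6; `--supports stmt-BirchSwinnertonDyer-19075`).  Supersedes, on
the `t ≥ 1` rows, acc3 g3's road of record (R₁) (`KimAtThreeDeepLowerOffStratumAdditiveDefectTorsionSplit.
torsionRows_of_deepPortsTwoExp`: deep-guard PORT₂ + the FLAGGED ports S24-DEEP (1)(2)) by the SAME deep-guard port
+ the PINNED Literature facts; and CORRECTS this seat's `KimAtThreeDeepLowerPortTorsion` (p481375), whose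
pinned-guard `t`-slot-`t` port over-asks at `t ≥ 1` (ERRATUM there): by [MR04] App. A, Prop. A.2, when
`E(ℚ₃)[3] ≠ 0` the derivative classes satisfy the CANONICAL condition at `3` only on a deep class `𝒫_j`
(`𝓕_can(ℚ₃, E[3^{k+1}]) = im H¹(ℚ₃, E[3^{j+1}])` for `j − k ≥ N₀`, the torsion-stable level; tree: n1011 T-DER-BP
`PropagatedConditionStableRangeThree`), so the faithful `t ≥ 1` port has guards `(k + N) k` (n1011's (B6) shape,
acc6's PORT₂ with `t ↦ N`): data at depth `k` with primes in the class of depth `k + N`.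

HONEST FRAMING. TOOL theorems only (no definition, no named fact, no `sorry`); nothing asserted about any curve,
nothing booked; 19075 / 19679 stay OPEN; BSD is not proved by any of this.  CONDITIONAL, by hypothesis, on
[S24] Thm. 4.4 (1)(2) PINNED (`hS24`/`hS24₂`, PUB), GZK, Poitou–Tate, and ONE displayed deep-guard port (FLAG
`K22-Thm3.13-PORT@3`; NOT in print at `3`; its discharger-to-be = a two-depth version of acc1 g2's D6b road —
n1011's `exists_derivativeFamily` ×2 with one `σ`, `isKolyvaginSystem_derivativeFamily_of_transverse_eq` with the
local condition at `3` fed by T-DER-BP instead of `ht0`, `map_derivativeFamily_eq` for (COMP) — NOT assembled).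

* §1 `padicValRat_ratPlusSymbol_le_of_kolyvaginProduct_nested_twoExp_deep_unlocked` — acc3 g2's §1 (acc6's
  END ONE CLASS DEEPER: shallow datum on the deep class of exponent `c`, certificate at `n ∈ 𝒩_{c+1}`) with the
  dictionary UNLOCKED (no `Addv`, no `#E(ℚ₃)[3] = 3^t` binder): ends in w2-c4 g7's
  `…UnlockedEnd.padicValRat_ratPlusSymbol_le_of_certificate_of_transport_nested_twoExp_unlocked`; proof text
  acc3's (credit acc3 / acc6 / w2-c4 / kim3 / cell b2b-bsdres n1011).
* §2 `padicValRat_ratPlusSymbol_le_of_towerSurj_deep_twoExp_unlocked_pinned` — acc3 g2's §2 on this seat's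
  PINNED-fact deep family (`KimAtThreeDeepLowerDeepFamilyOfPinned.exists_deepFamily_of_pinned_with`, class shift
  `N`, certificate depth `k ≥ 1`): Cor C-t from a minimal certificate at a cyclic `n ∈ 𝒩_{k+N+1}`, `t + j ≤ k + 1`,
  GRANTED `hS24 hS24₂ hGZK hPT` and the deep-guard unlocked port at `(t, e)` with shift `N`.  NO S24-DEEP port.
* §3 `deepLower_row_of_portDeep_tors` — the LOWER row `∃ d, ∂^{(∞)}_deep = d ∧ ∂⁽⁰⁾ ≤ ord₃ #Ш(3) + d` at ANY
  tower row with the datum at the conductor (acc3's descent at `K = N + t + 2`).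
References: [MazurRubin2004] Thm. 3.2.4, §3.5 (H.5), Thm. 5.2.12, App. A Prop. A.2 (pp. 79–80); [Kim2022StructureSelmer]
Thm. 1.9 (6), Thm. 3.13, §3.3.2; [Kim2025RefinedTNC] Thm 1.1; [Sakamoto2024] Thm. 4.4 (1)(2); [MilneADT2006] I Thm. 4.10.
-/

set_option autoImplicit false
-- the Theorems namespace of a single-conjunct summit repeats the summit name by design (D-0017)
set_option linter.dupNamespace false

noncomputable section

open scoped Classical NumberField ContRepresentation
open Function Field NumberField IsDedekindDomain IsDedekindDomain.HeightOneSpectrum WeierstrassCurve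
  CongruenceSubgroup
  Literature.NumberTheory.EllipticCurves Literature.NumberTheory.EllipticCurves.ModularForms
  Literature.NumberTheory.EllipticCurves.Rank1Residual
  Literature.NumberTheory.GaloisRepresentations
  Literature.NumberTheory.GaloisRepresentations.DiscreteGaloisModule Literature.NumberTheory.GaloisCohomology
  Rat.HeightOneSpectrum
  Summit.BirchSwinnertonDyer.Rank1Residual.GaloisImage
  Summit.BirchSwinnertonDyer.Rank1Residual.GaloisImage.Assembly
  Summit.BirchSwinnertonDyer.Rank1Residual.GaloisImage.S24Deep
  Summit.BirchSwinnertonDyer.Rank1Residual.X4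
  Summit.BirchSwinnertonDyer.BirchSwinnertonDyer.Theorems.KimAtThreeKolyvaginUnitLevelOneRungs
  Summit.BirchSwinnertonDyer.BirchSwinnertonDyer.Theorems.KimAtThreeKolyvaginCertificateDictionary
  Summit.BirchSwinnertonDyer.BirchSwinnertonDyer.Theorems.KimAtThreeKolyvaginMinimalCertificate
  Summit.BirchSwinnertonDyer.BirchSwinnertonDyer.Theorems.KimAtThreeDeepLowerKatoStratumOfFacts
  Summit.BirchSwinnertonDyer.BirchSwinnertonDyer.Theorems.KimAtThreeDeepLowerDeepPortWith
  Summit.BirchSwinnertonDyer.BirchSwinnertonDyer.Theorems.KimAtThreeKolyvaginDefs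
  Summit.BirchSwinnertonDyer.BirchSwinnertonDyer.Theorems.KimAtThreeShallowEqDeepUnlockedEnd
  Summit.BirchSwinnertonDyer.BirchSwinnertonDyer.Theorems.KimAtThreeDeepLowerDeepFamilyOfPinned
  Summit.BirchSwinnertonDyer.BirchSwinnertonDyer.Theorems.KimAtThreeDeepLowerOffStratumAdditiveDefectPortTwoExp

namespace Summit.BirchSwinnertonDyer.BirchSwinnertonDyer.Theorems.KimAtThreeDeepLowerPortDeepTorsion

/-! ### §1 acc6's unlocked END, one class deeper -/

/-- **acc3 g2's `padicValRat_ratPlusSymbol_le_of_kolyvaginProduct_nested_twoExp_deep` with the dictionary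
UNLOCKED** — the shallow datum `D` (depth `k`) lies on the deep class through `E[3^{c+1}]` (any class exponent
`c`), the certificate is read at `n ∈ 𝒩_{c+1}(E,3)` in Kim's ℕ-currency with ONE `ψ`, the two-depth witnesses +
(COMP) are given as bare `∃` clauses (`hdict`; no `Addv`, no torsion binder): `ord₃ [0]⁺_{P.f} ≤ ord₃ #Ш(E/ℚ)(3) +
(j − 1)`.  Proof text acc3's, ending in w2-c4 g7's
`KimAtThreeShallowEqDeepUnlockedEnd.padicValRat_ratPlusSymbol_le_of_certificate_of_transport_nested_twoExp_unlocked`.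
[cite: Kim2022StructureSelmer, Thm. 1.9 (6), §1.2.2 and §1.4.3] [cite: Sakamoto2024, §2 and Thm. 4.4]
[cite: MazurRubin2004, Thm. 3.2.4, Thm. 4.4.1 and App. A (33)] -/
theorem padicValRat_ratPlusSymbol_le_of_kolyvaginProduct_nested_twoExp_deep_unlocked
    (W : WeierstrassCurve ℚ) [W.IsElliptic] [W.IsGloballyMinimal] (t e k c : ℕ)
    (D : KolyvaginDatum (W.torsionGaloisModule (((3 : ℕ) : ℤ) ^ k * ((3 : ℕ) : ℤ))))
    (v₃ : HeightOneSpectrum (𝓞 ℚ)) (hv₃ : ((3 : ℕ) : 𝓞 ℚ) ∈ v₃.asIdeal)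
    (hsurj : W.HasSurjectiveModNGaloisRep ((3 : ℕ) : ℤ))
    [Finite W.toAffine.Point] [Finite W.sha]
    {N : ℕ} [NeZero N] (P : ModularParametrizationData W N) (h0 : ratPlusSymbol P.f 0 ≠ 0)
    (hDT : D.transverse = cyclotomicTransverse _)
    (g : Finset (HeightOneSpectrum (𝓞 ℚ)) →
      galoisCohomology (W.torsionGaloisModule (((3 : ℕ) : ℤ) ^ k * ((3 : ℕ) : ℤ))) 1)
    (hg : g ∈ D.kolyvaginSystems (propagatedSelmerStructure W 3 k))
    (hgen : ∀ κ ∈ D.kolyvaginSystems (propagatedSelmerStructure W 3 k), ∃ a : ℕ, κ = a • g)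
    (D' : ∀ k' : ℕ, KolyvaginDatum (W.torsionGaloisModule (((3 : ℕ) : ℤ) ^ k' * ((3 : ℕ) : ℤ))))
    (hDT' : ∀ k', (D' k').transverse = cyclotomicTransverse _)
    (hPP' : ∀ k', k ≤ k' → (D' k').primes ⊆ D.primes)
    (red : ∀ k' : ℕ, (W.torsionGaloisModule (((3 : ℕ) : ℤ) ^ k' * ((3 : ℕ) : ℤ))).toContRepresentation
      →ⁱL (W.torsionGaloisModule (((3 : ℕ) : ℤ) ^ k * ((3 : ℕ) : ℤ))).toContRepresentation)
    (hred : ∀ k', ∀ x : geomTorsion W (((3 : ℕ) : ℤ) ^ k' * ((3 : ℕ) : ℤ)),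
      ((red k' x : geomTorsion W (((3 : ℕ) : ℤ) ^ k * ((3 : ℕ) : ℤ))) : geomPoints W) =
        (((3 : ℕ) : ℤ) ^ (k' - k)) • (x : geomPoints W))
    (hdict : ∀ k', k ≤ k' → ∃ κ Λ κ' κu Λu κu',
        KatoKuriharaWitnessAtTwoExp W k t e D v₃ P κ Λ κ' ∧
        KatoKuriharaWitnessAtTwoExp W k' t e (D' k') v₃ P κu Λu κu' ∧
        ∀ d, (D' k').IsLevel d → D.IsLevel d →
          galoisCohomology.map (red k') 1 (κu d) = κ d ∧ galoisCohomology.map (red k') 1 (κu' d) = κ' d)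
    (g' : ∀ k' : ℕ, Finset (HeightOneSpectrum (𝓞 ℚ)) →
      galoisCohomology (W.torsionGaloisModule (((3 : ℕ) : ℤ) ^ k' * ((3 : ℕ) : ℤ))) 1)
    (hg' : ∀ k', g' k' ∈ (D' k').kolyvaginSystems (propagatedSelmerStructure W 3 k'))
    (hgo' : ∀ k', addOrderOf (g' k') = 3 ^ (k' + 1))
    (hgen' : ∀ k', ∀ κ ∈ (D' k').kolyvaginSystems (propagatedSelmerStructure W 3 k'),
      ∃ a : ℕ, κ = a • g' k')
    (inv' : ∀ k' : ℕ, LocalInvariants ℚ (3 ^ (k' + 1))) (hperf' : ∀ k', (inv' k').IsPerfect)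
    (hsum' : ∀ k', (inv' k').SumLocalTermEqZero) (hcompl' : ∀ k', (inv' k').SelmerComplement)
    (hinj' : ∀ k', ∀ v : HeightOneSpectrum (𝓞 ℚ), Injective (inv' k' (Sum.inr v)))
    (hEP : ∀ v : HeightOneSpectrum (𝓞 ℚ), localEulerPoincareCharacteristic (v.adicCompletion ℚ))
    (T : ∀ k' : ℕ, Finset (HeightOneSpectrum (𝓞 ℚ))) (hv₃T : ∀ k', v₃ ∈ T k')
    (hT : ∀ k', ∀ v : HeightOneSpectrum (𝓞 ℚ), v ∉ T k' →
      (((3 ^ (k' + 1) : ℕ) : ℕ) : 𝓞 ℚ) ∉ v.asIdeal ∧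
        GaloisRep.IsUnramifiedAt v (W.torsionGaloisModule (((3 : ℕ) : ℤ) ^ k' * ((3 : ℕ) : ℤ))))
    (h𝓕T : ∀ k', (propagatedSelmerStructure W 3 k').IsUnramifiedOutside (finSupport (T k')))
    (h𝓚T : ∀ k', (W.kummerSelmerStructure (((3 : ℕ) : ℤ) ^ k' * ((3 : ℕ) : ℤ))).IsUnramifiedOutside
      (finSupport (T k')))
    (hfinT : ∀ k', Finite (geomTorsion W (((3 : ℕ) : ℤ) ^ k' * ((3 : ℕ) : ℤ))))
    (hfinS : ∀ k', Finite (W.kummerSelmerStructure (((3 : ℕ) : ℤ) ^ k' * ((3 : ℕ) : ℤ))).selmerGroup)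
    (hPS : ∀ q ∈ D.primes, q ∉ T k) (hPS' : ∀ k', ∀ q ∈ (D' k').primes, q ∉ T k')
    (hUT : ∀ q ∈ D.primes,
      Nat.card (unramifiedSubgroup (GaloisRep.toLocal q
        (W.torsionGaloisModule (((3 : ℕ) : ℤ) ^ k * ((3 : ℕ) : ℤ)))) 1) =
        Nat.card (D.transverse (Sum.inr q)))
    (hUT' : ∀ k', ∀ q ∈ (D' k').primes,
      Nat.card (unramifiedSubgroup (GaloisRep.toLocal q
        (W.torsionGaloisModule (((3 : ℕ) : ℤ) ^ k' * ((3 : ℕ) : ℤ)))) 1) =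
        Nat.card ((D' k').transverse (Sum.inr q)))
    (hR22D : ∀ d, D.IsLevel d →
      (Nat.card ((inv' k).dualSelmerStructure _
          (D.atLevel (propagatedSelmerStructure W 3 k) d)).selmerGroup ∣ 3 ^ (k + 1) →
        addOrderOf (g d) * Nat.card ((inv' k).dualSelmerStructure _
          (D.atLevel (propagatedSelmerStructure W 3 k) d)).selmerGroup = 3 ^ (k + 1)) ∧
      (3 ^ (k + 1) ∣ Nat.card ((inv' k).dualSelmerStructure _
          (D.atLevel (propagatedSelmerStructure W 3 k) d)).selmerGroup → g d = 0))
    (hR22' : ∀ k' d, (D' k').IsLevel d →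
      (Nat.card ((inv' k').dualSelmerStructure _
          ((D' k').atLevel (propagatedSelmerStructure W 3 k') d)).selmerGroup ∣ 3 ^ (k' + 1) →
        addOrderOf (g' k' d) * Nat.card ((inv' k').dualSelmerStructure _
          ((D' k').atLevel (propagatedSelmerStructure W 3 k') d)).selmerGroup = 3 ^ (k' + 1)) ∧
      (3 ^ (k' + 1) ∣ Nat.card ((inv' k').dualSelmerStructure _
          ((D' k').atLevel (propagatedSelmerStructure W 3 k') d)).selmerGroup → g' k' d = 0))
    -- the shallow datum is a `τ`-datum on the DEEP class through `E[3^{c+1}]`; `ρ_{E,3^{c+1}}` onto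
    {S : Set (HeightOneSpectrum (𝓞 ℚ))} {τ : absoluteGaloisGroup ℚ}
    (hτμ : τ ∈ rootsOfUnityFixer ℚ (3 ^ (c + 1)))
    (hτq : Nonempty (cokerSubOne (W.torsionGaloisModule (((3 : ℕ) : ℤ) ^ c * ((3 : ℕ) : ℤ))) τ ≃+
      ZMod (3 ^ (c + 1))))
    (hDP : D.primes = frobeniusClassPrimes
      (W.torsionGaloisModule (((3 : ℕ) : ℤ) ^ c * ((3 : ℕ) : ℤ))) S τ (3 ^ (c + 1)))
    (hsurjK : W.HasSurjectiveModNGaloisRep (((3 : ℕ) : ℤ) ^ c * ((3 : ℕ) : ℤ)))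
    -- the certificate in Kim's currency, at `n ∈ 𝒩_{c+1}`
    (n : ℕ) [NeZero n] (hn : Kato.IsKolyvaginProduct W 3 (c + 1) n)
    (hflag : ∀ v : HeightOneSpectrum (𝓞 ℚ), Ideal.absNorm v.asIdeal ∣ n →
      Nat.card (AddSubgroup.torsionBy (W.reductionAt v).toAffine.Point (3 : ℕ)) ≤ 3)
    (hnS : ∀ v : HeightOneSpectrum (𝓞 ℚ), Ideal.absNorm v.asIdeal ∣ n → v ∉ S)
    (hnN : ∀ ℓ ∈ n.primeFactors, ¬ ℓ ∣ N) {j : ℕ} (htj : t + j ≤ k + 1)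
    (ψ : (ℓ : ℕ) → (ZMod ℓ)ˣ →* Multiplicative (ZMod (3 ^ j)))
    (hψ : ∀ ℓ ∈ n.primeFactors, Function.Surjective (ψ ℓ))
    (hcert : kuriharaNumber P.f (3 ^ j) n ψ ≠ 0)
    (hv : ∀ d : ℕ, d ∣ n → 1 < d → d < n → ∀ [NeZero d], kuriharaNumber P.f (3 ^ j) d ψ = 0) :
    padicValRat 3 (ratPlusSymbol P.f 0) ≤
      (padicValNat 3 (Nat.card (AddCommGroup.primaryComponent W.sha 3)) : ℤ) + ((j - 1 : ℕ) : ℤ) := by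
  haveI : Fact (Nat.Prime 3) := ⟨Nat.prime_three⟩
  -- the places of `n` form a level of `D`
  obtain ⟨nF, hsub, hprod, hmem⟩ := FrobShape.exists_level_of_kolyvaginProduct W 3
    (Nat.succ_pos c) hn hflag (((3 : ℕ) : ℤ) ^ c * ((3 : ℕ) : ℤ)) (by push_cast; rw [pow_succ]) hsurjK
    hτμ hτq hnS
  have hlev : D.IsLevel nF := by
    change (↑nF : Set _) ⊆ D.primes
    rw [hDP]
    exact hsub
  have hprime : ∀ q ∈ nF, (Ideal.absNorm q.asIdeal).Prime := fun q hq =>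
    Nat.prime_of_mem_primeFactors (hmem q hq)
  have hinj := absNorm_injOn (↑nF : Set (HeightOneSpectrum (𝓞 ℚ)))
  have hn0 : n ≠ 0 := hn.ne_zero
  have hdvd : ∀ c' ⊆ nF, (∏ q ∈ c', Ideal.absNorm q.asIdeal) ∣ n := fun c' hc' => by
    rw [← hprod]; exact Finset.prod_dvd_prod_of_subset _ _ _ hc'
  refine padicValRat_ratPlusSymbol_le_of_certificate_of_transport_nested_twoExp_unlocked W t e k D v₃ hv₃ hsurj
    P h0 hDT g hg hgen D' hDT' hPP' red hred hdict g' hg' hgo' hgen' inv' hperf' hsum' hcompl' hinj' hEP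
    T hv₃T hT h𝓕T h𝓚T hfinT hfinS hPS hPS' hUT hUT' hR22D hR22' nF hlev htj ?_ (ψ₀ := ψ) ?_ ?_ ?_
  · intro q hq
    exact (Nat.Prime.coprime_iff_not_dvd (hprime q hq)).mpr (hnN _ (hmem q hq))
  · exact fun q hq => hψ _ (hmem q hq)
  · rw [kuriharaNumber_congr_level P.f (3 ^ j) hprod _ inferInstance ψ]
    exact hcert
  · intro c' hc' hne ψ' hψ'
    set d := ∏ q ∈ c', Ideal.absNorm q.asIdeal with hd
    have hd0 : d ≠ 0 := Finset.prod_ne_zero_iff.2 fun q _ => absNorm_ne_zero q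
    haveI : NeZero d := ⟨hd0⟩
    have hdn : d ∣ n := hdvd c' hc'.subset
    have h1d : 1 < d := by
      obtain ⟨q₀, hq₀⟩ := hne
      have hle : Ideal.absNorm q₀.asIdeal ≤ d :=
        Nat.le_of_dvd (Nat.pos_of_ne_zero hd0) (Finset.dvd_prod_of_mem _ hq₀)
      exact lt_of_lt_of_le (hprime q₀ (hc'.subset hq₀)).one_lt hle
    have hdlt : d < n := by
      have hsd : (nF \ c').Nonempty := Finset.sdiff_nonempty.mpr hc'.not_subset
      obtain ⟨q₁, hq₁⟩ := hsd
      have hsplit := Finset.prod_sdiff (f := fun q => Ideal.absNorm q.asIdeal) hc'.subset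
      rw [hprod] at hsplit
      have h1 : 1 < ∏ q ∈ nF \ c', Ideal.absNorm q.asIdeal := by
        have hle : Ideal.absNorm q₁.asIdeal ≤ ∏ q ∈ nF \ c', Ideal.absNorm q.asIdeal :=
          Nat.le_of_dvd (Nat.pos_of_ne_zero (Finset.prod_ne_zero_iff.2 fun q _ => absNorm_ne_zero q))
            (Finset.dvd_prod_of_mem _ hq₁)
        exact lt_of_lt_of_le (hprime q₁ (Finset.sdiff_subset hq₁)).one_lt hle
      calc d = 1 * d := (one_mul d).symm
        _ < (∏ q ∈ nF \ c', Ideal.absNorm q.asIdeal) * d := Nat.mul_lt_mul_of_pos_right h1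
            (Nat.pos_of_ne_zero hd0)
        _ = n := hsplit
    have hzero : kuriharaNumber P.f (3 ^ j) d ψ = 0 := hv d hdn h1d hdlt
    have hψd : ∀ ℓ ∈ d.primeFactors, Function.Surjective (ψ ℓ) := fun ℓ hℓ =>
      hψ ℓ (Nat.primeFactors_mono hdn hn0 hℓ)
    have hψ'd : ∀ ℓ ∈ d.primeFactors, Function.Surjective (ψ' ℓ) :=
      Shallow.forall_primeFactors_of_forall_mem (fun q : HeightOneSpectrum (𝓞 ℚ) =>
        Ideal.absNorm q.asIdeal) c' (fun q hq => hprime q (hc'.subset hq)) (hinj.mono hc'.subset) hψ'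
    obtain ⟨u, hu⟩ := exists_units_kuriharaNumber_eq_mul P.f (3 ^ j) d hψd hψ'd
    change kuriharaNumber P.f (3 ^ j) d ψ' = 0
    rw [hu, hzero, mul_zero]

/-! ### §2 The assembly on the PINNED-fact deep family, GRANTED the deep-guard unlocked port -/

/-- **Cor C-t on `[0]⁺_f`, every `t`, every defect exponent `e`, every depth `k ≥ 1`, class shift `M`, GRANTED
the deep-guard unlocked port — NO S24-DEEP port.**  `W/ℚ` globally minimal, ANY reduction at `3`, the `3`-adic
tower onto, `[0]⁺_{P.f} ≠ 0`, a parametrisation datum `P` (no Manin / period binder); GRANTED [S24] Thm. 4.4 (1)(2)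
PINNED (`hS24`/`hS24₂`), `hGZK`, `hPT`, generators `η`, and the port: for all depths `k ≤ k′`, all `τ`-data `Dk`,
`Dk′` canonical for `η` with primes in the classes of depth `k + M`, `k′ + M`, every pinned `red`, the two-depth
witnesses `KatoKuriharaWitnessAtTwoExp W · t e · v₃ P` + (COMP); a MINIMAL certificate of modulus `3^j` at a
cyclic `n ∈ 𝒩_{k+M+1}(E,3)` (`ℓ ∤ N` for `ℓ ∣ n`) with `t + j ≤ k + 1` ⟹ `ord₃ [0]⁺_{P.f} ≤ ord₃ #Ш(E/ℚ)(3) +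
(j − 1)`.  Proof = acc3 g2's §2 with the deep family of `KimAtThreeDeepLowerDeepFamilyOfPinned` (PINNED facts)
in place of gen 0's port-keyed one, ending in §1.  In nature `M = N₀` (torsion-stable level of `E(ℚ₃)`; [MR04]
Prop. A.2). [cite: Kim2022StructureSelmer, Thm. 1.9 (6) and Thm. 3.13] [cite: Sakamoto2024, Thm. 4.4 (p. 926)]
[cite: MazurRubin2004, §3.5 (H.5) (p. 27) and Prop. A.2 (pp. 79–80)] [cite: MilneADT2006, Ch. I, Thm. 4.10] -/
theorem padicValRat_ratPlusSymbol_le_of_towerSurj_deep_twoExp_unlocked_pinned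
    (hS24 : Sakamoto2024.kolyvaginSystems_freeRankOne_zmod_three_pow)
    (hS24₂ : Sakamoto2024.kolyvaginSystems_idealOfBasis_eq_fittingIdeal_zmod_three_pow)
    (hGZK : rank_eq_analyticRank_of_analyticRank_le_one)
    (hPT : poitouTate_selmerStructure_duality ℚ)
    (W : WeierstrassCurve ℚ) [W.IsElliptic] [W.IsGloballyMinimal] (t e M k : ℕ) (hk : 1 ≤ k)
    (htower : ∀ m : ℕ, W.HasSurjectiveModNGaloisRep (3 ^ m : ℕ))
    {N : ℕ} [NeZero N] (P : ModularParametrizationData W N) (h0 : ratPlusSymbol P.f 0 ≠ 0)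
    (v₃ : HeightOneSpectrum (𝓞 ℚ)) (hv₃ : ((3 : ℕ) : 𝓞 ℚ) ∈ v₃.asIdeal)
    (η : (q : HeightOneSpectrum (𝓞 ℚ)) → (ZMod (Ideal.absNorm q.asIdeal))ˣ)
    (hη : ∀ q : HeightOneSpectrum (𝓞 ℚ), Subgroup.zpowers (η q) = ⊤)
    (hPort : ∀ (k k' : ℕ) (Dk : KolyvaginDatum (W.torsionGaloisModule (((3 : ℕ) : ℤ) ^ k * ((3 : ℕ) : ℤ))))
      (Dk' : KolyvaginDatum (W.torsionGaloisModule (((3 : ℕ) : ℤ) ^ k' * ((3 : ℕ) : ℤ))))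
      (red : (W.torsionGaloisModule (((3 : ℕ) : ℤ) ^ k' * ((3 : ℕ) : ℤ))).toContRepresentation →ⁱL
        (W.torsionGaloisModule (((3 : ℕ) : ℤ) ^ k * ((3 : ℕ) : ℤ))).toContRepresentation),
      Dk.IsCanonicalTauDatumThreeAtWith W (k + M) k η → Dk'.IsCanonicalTauDatumThreeAtWith W (k' + M) k' η →
      k ≤ k' →
      (∀ x : geomTorsion W (((3 : ℕ) : ℤ) ^ k' * ((3 : ℕ) : ℤ)),
        ((red x : geomTorsion W (((3 : ℕ) : ℤ) ^ k * ((3 : ℕ) : ℤ))) : geomPoints W) =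
          (((3 : ℕ) : ℤ) ^ (k' - k)) • (x : geomPoints W)) →
      ∃ κ Λ κ' κu Λu κu',
        KatoKuriharaWitnessAtTwoExp W k t e Dk v₃ P κ Λ κ' ∧
        KatoKuriharaWitnessAtTwoExp W k' t e Dk' v₃ P κu Λu κu' ∧
        ∀ d, Dk'.IsLevel d → Dk.IsLevel d →
          galoisCohomology.map red 1 (κu d) = κ d ∧ galoisCohomology.map red 1 (κu' d) = κ' d)
    (n : ℕ) [NeZero n] (hn : Kato.IsKolyvaginProduct W 3 (k + M + 1) n)
    (hcyc : ∀ (ℓ : ℕ) [Fact ℓ.Prime], ℓ ∣ n →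
      Nat.card {P : ((integralModelInt W).map (Int.castRingHom (ZMod ℓ))).toAffine.Point //
        3 • P = 0} ≤ 3)
    (hnN : ∀ ℓ ∈ n.primeFactors, ¬ ℓ ∣ N) {j : ℕ} (htj : t + j ≤ k + 1)
    (ψ : (ℓ : ℕ) → (ZMod ℓ)ˣ →* Multiplicative (ZMod (3 ^ j)))
    (hψ : ∀ ℓ ∈ n.primeFactors, Function.Surjective (ψ ℓ))
    (hcert : kuriharaNumber P.f (3 ^ j) n ψ ≠ 0)
    (hv : ∀ d : ℕ, d ∣ n → 1 < d → d < n → ∀ [NeZero d], kuriharaNumber P.f (3 ^ j) d ψ = 0) :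
    padicValRat 3 (ratPlusSymbol P.f 0) ≤
      (padicValNat 3 (Nat.card (AddCommGroup.primaryComponent W.sha 3)) : ℤ) + ((j - 1 : ℕ) : ℤ) := by
  haveI : Fact (Nat.Prime 3) := ⟨Nat.prime_three⟩
  have hL : W.entireLFunction 1 ≠ 0 :=
    P.isNewformOf.entireLFunction_one_ne_zero_of_ratPlusSymbol_zero_ne_zero h0
  have hr : W.analyticRank = 0 := analyticRank_eq_zero_of_entireLFunction_one_ne_zero hL
  have hGZ := hGZK W (by rw [hr]; exact zero_le_one)
  haveI : Finite W.sha := hGZ.2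
  haveI : Finite W.toAffine.Point := W.mordellWeilRank_eq_zero_iff_holds.mp (by rw [hGZ.1, hr])
  have hsurj : W.HasSurjectiveModNGaloisRep ((3 : ℕ) : ℤ) := by simpa using htower 1
  obtain ⟨inv, hperf, hsum, -, hcompl⟩ := hPT 3
  obtain ⟨inv', hperf', hsum', hcompl', hinj'⟩ := exists_localInvariants_three_pow_of_poitouTate hPT
  have hEP : ∀ v : HeightOneSpectrum (𝓞 ℚ), localEulerPoincareCharacteristic (v.adicCompletion ℚ) :=
    localEulerPoincareCharacteristic_rat
  obtain ⟨T, h3T, hbadT, hTmem, hT, h𝓕T, h𝓚T, hfinT, hfinS⟩ := TowerPackage.towerAdmissible W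
  have hS : ∀ w : InfinitePlace ℚ, (Sum.inl w : Place ℚ) ∈ finSupport T := inl_mem_finSupport T
  have h3S : ∀ v : HeightOneSpectrum (𝓞 ℚ), ((3 : ℕ) : 𝓞 ℚ) ∈ v.asIdeal →
      (Sum.inr v : Place ℚ) ∈ finSupport T := fun v hv => (inr_mem_finSupport_iff T v).mpr (h3T v hv)
  have hbadS : ∀ v : HeightOneSpectrum (𝓞 ℚ), ¬ W.HasGoodReductionAt v →
      (Sum.inr v : Place ℚ) ∈ finSupport T := fun v hv => (inr_mem_finSupport_iff T v).mpr (hbadT v hv)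
  have hSgood : ∀ v ∉ {v : HeightOneSpectrum (𝓞 ℚ) | (Sum.inr v : Place ℚ) ∈ finSupport T},
      W.HasGoodReductionAt v ∧ ((3 : ℕ) : 𝓞 ℚ) ∉ v.asIdeal := fun v hv =>
    ⟨by_contra fun h => hv (hbadS v h), fun h => hv (h3S v h)⟩
  have hSmem : ∀ v ∈ {v : HeightOneSpectrum (𝓞 ℚ) | (Sum.inr v : Place ℚ) ∈ finSupport T},
      ¬ W.HasGoodReductionAt v ∨ ((3 : ℕ) : 𝓞 ℚ) ∈ v.asIdeal := fun v hv =>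
    hTmem v ((inr_mem_finSupport_iff T v).mp hv)
  obtain ⟨τ, hτμ, hτq⟩ := S24Deep.exists_tau_forall_levels_of_towerSurj W htower
  -- the PINNED-fact deep family (class shift `M`, certificate depth `k ≥ 1`), shared `η`
  obtain ⟨D', g', hP', hDT', hD', hPP', hPS', hUT', hg', hgo', hgen', hR22'⟩ :=
    exists_deepFamily_of_pinned_with W hS24 hS24₂ M k hk htower τ hτμ hτq inv hperf hsum hcompl hEP
      (finSupport T) hS h3S hbadS hfinT η hη
  choose red hred using fun k' => exists_torsionReduction_three W k k'
  have hk0 : k ≠ 0 := Nat.one_le_iff_ne_zero.mp hk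
  -- the members at depths `k′ ≥ k` lie on the class of depth `k′ + M`
  have hcls : ∀ k', k ≤ k' → (D' k').primes = frobeniusClassPrimes
      (W.torsionGaloisModule (((3 : ℕ) : ℤ) ^ (k' + M) * ((3 : ℕ) : ℤ)))
      {v | (Sum.inr v : Place ℚ) ∈ finSupport T} τ (3 ^ (k' + M + 1)) := fun k' hkk' => by
    have h := hP' k'
    have hk'0 : k' ≠ 0 := fun h0 => hk0 (Nat.le_zero.mp (h0 ▸ hkk'))
    rw [if_neg hk'0, max_eq_right hkk'] at h
    exact h
  -- the deep With-guards for `η`, and the dictionary from the port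
  have hguard : ∀ k', k ≤ k' → (D' k').IsCanonicalTauDatumThreeAtWith W (k' + M) k' η :=
    fun k' hkk' => ⟨hDT' k', hD' k', _, τ, hSgood, hτμ _, hτq _, (hcls k' hkk').le⟩
  have hdict : ∀ k', k ≤ k' → ∃ κ Λ κ' κu Λu κu',
      KatoKuriharaWitnessAtTwoExp W k t e (D' k) v₃ P κ Λ κ' ∧
      KatoKuriharaWitnessAtTwoExp W k' t e (D' k') v₃ P κu Λu κu' ∧
      ∀ d, (D' k').IsLevel d → (D' k).IsLevel d →
        galoisCohomology.map (red k') 1 (κu d) = κ d ∧ galoisCohomology.map (red k') 1 (κu' d) = κ' d :=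
    fun k' hkk' => hPort k k' (D' k) (D' k') (red k') (hguard k le_rfl) (hguard k' hkk') hkk' (hred k')
  have hsurjK : W.HasSurjectiveModNGaloisRep (((3 : ℕ) : ℤ) ^ (k + M) * ((3 : ℕ) : ℤ)) := by
    simpa only [Nat.cast_pow, Nat.cast_mul, pow_succ] using htower (k + M + 1)
  -- §1 at class exponent `k + M`, shallow datum `D′ k`
  exact padicValRat_ratPlusSymbol_le_of_kolyvaginProduct_nested_twoExp_deep_unlocked W t e k (k + M) (D' k) v₃
    hv₃ hsurj P h0 (hDT' k) (g' k) (hg' k) (hgen' k) D' hDT' hPP' red hred hdict g' hg' hgo' hgen' inv'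
    hperf' hsum' hcompl' hinj' hEP (fun _ => T) (fun _ => h3T v₃ hv₃) hT h𝓕T h𝓚T hfinT hfinS
    (fun q hq => fun h => hPS' k q hq ((inr_mem_finSupport_iff T q).mpr h))
    (fun k' q hq => fun h => hPS' k' q hq ((inr_mem_finSupport_iff T q).mpr h))
    (hUT' k) hUT'
    (fun d hd => hR22' k (inv' k) (hperf' k) (hsum' k) (hcompl' k) d hd)
    (fun k' d hd => hR22' k' (inv' k') (hperf' k') (hsum' k') (hcompl' k') d hd)
    (hτμ _) (hτq _) (hcls k le_rfl) hsurjK n hn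
    (fun v hv => natCard_torsionBy_reductionAt_le_of_dvd W 3 hcyc hv)
    (fun v hv h => by
      obtain ⟨hgood, h3⟩ := hasGoodReductionAt_and_not_mem_of_kolyvaginProduct W 3 hn hv
      rcases hSmem v h with hbad | h3v
      · exact hbad hgood
      · exact h3 h3v)
    hnN htj ψ hψ hcert hv

/-! ### §3 The LOWER row at ANY tower row, ANY `t`, from PUB + the deep-guard port -/

/-- **LOWER row (cruxes 19075 / 19679) at ANY tower row with the datum at the conductor, ANY local `3`-torsion
exponent `t` and class shift `M` in the port: `∃ d, ∂^{(∞)}_deep = d ∧ ∂⁽⁰⁾ ≤ ord₃ #Ш(3) + d`** from [S24] (1)(2)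
PINNED, GZK, Poitou–Tate and the deep-guard unlocked port at `(t, e, M)` — NO S24-DEEP port, NO reduction-type /
Tamagawa / Manin / period binder.  acc3 g2's descent `deepLower_datum_of_plusSymbolEndShapeBound` at
`K = M + t + 2` over §2 at depth `k = L − M − 1 ≥ 1` (certificate at a cyclic `n ∈ 𝒩_L`, modulus `3^{j′}`).
In nature `M = N₀`, the torsion-stable level of `E(ℚ₃)` ([MR04] Prop. A.2; `N₀ ≤ 2` at an additive `3`).
[cite: Kim2022StructureSelmer, Thm. 1.9 (6), Thm. 3.13, §1.5.1] [cite: Kim2025RefinedTNC, Thm 1.1]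
[cite: Sakamoto2024, Thm. 4.4 (p. 926)] [cite: MazurRubin2004, Def. 5.2.11, Thm. 5.2.12 (i), Prop. A.2]
[cite: MilneADT2006, Ch. I, Thm. 4.10] -/
theorem deepLower_row_of_portDeep_tors
    (hS24 : Sakamoto2024.kolyvaginSystems_freeRankOne_zmod_three_pow)
    (hS24₂ : Sakamoto2024.kolyvaginSystems_idealOfBasis_eq_fittingIdeal_zmod_three_pow)
    (hGZK : rank_eq_analyticRank_of_analyticRank_le_one) (hPT : poitouTate_selmerStructure_duality ℚ)
    (W : WeierstrassCurve ℚ) [W.IsElliptic] [W.IsGloballyMinimal]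
    (htower : ∀ m : ℕ, W.HasSurjectiveModNGaloisRep (3 ^ m : ℕ))
    {N : ℕ} [NeZero N] (hN : N = W.conductorNorm ℤ) (D : ModularParametrizationData W N) (t e M : ℕ)
    (hord : kuriharaVanishingOrder W 3 D.f = 0)
    (v₃ : HeightOneSpectrum (𝓞 ℚ)) (hv₃ : ((3 : ℕ) : 𝓞 ℚ) ∈ v₃.asIdeal)
    (η : (q : HeightOneSpectrum (𝓞 ℚ)) → (ZMod (Ideal.absNorm q.asIdeal))ˣ)
    (hη : ∀ q : HeightOneSpectrum (𝓞 ℚ), Subgroup.zpowers (η q) = ⊤)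
    (hPort : ∀ (k k' : ℕ) (Dk : KolyvaginDatum (W.torsionGaloisModule (((3 : ℕ) : ℤ) ^ k * ((3 : ℕ) : ℤ))))
      (Dk' : KolyvaginDatum (W.torsionGaloisModule (((3 : ℕ) : ℤ) ^ k' * ((3 : ℕ) : ℤ))))
      (red : (W.torsionGaloisModule (((3 : ℕ) : ℤ) ^ k' * ((3 : ℕ) : ℤ))).toContRepresentation →ⁱL
        (W.torsionGaloisModule (((3 : ℕ) : ℤ) ^ k * ((3 : ℕ) : ℤ))).toContRepresentation),
      Dk.IsCanonicalTauDatumThreeAtWith W (k + M) k η → Dk'.IsCanonicalTauDatumThreeAtWith W (k' + M) k' η →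
      k ≤ k' →
      (∀ x : geomTorsion W (((3 : ℕ) : ℤ) ^ k' * ((3 : ℕ) : ℤ)),
        ((red x : geomTorsion W (((3 : ℕ) : ℤ) ^ k * ((3 : ℕ) : ℤ))) : geomPoints W) =
          (((3 : ℕ) : ℤ) ^ (k' - k)) • (x : geomPoints W)) →
      ∃ κ Λ κ' κu Λu κu',
        KatoKuriharaWitnessAtTwoExp W k t e Dk v₃ D κ Λ κ' ∧
        KatoKuriharaWitnessAtTwoExp W k' t e Dk' v₃ D κu Λu κu' ∧
        ∀ d, Dk'.IsLevel d → Dk.IsLevel d →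
          galoisCohomology.map red 1 (κu d) = κ d ∧ galoisCohomology.map red 1 (κu' d) = κ' d) :
    ∃ d : ℕ, kuriharaPartialDeepInfty W 3 D.f = d ∧
      kuriharaPartial W 3 D.f 0 ≤
        ((padicValNat 3 (Nat.card (AddCommGroup.primaryComponent W.sha 3)) + d : ℕ) : ℕ∞) := by
  haveI : Fact (Nat.Prime 3) := ⟨Nat.prime_three⟩
  have h0 : ratPlusSymbol D.f 0 ≠ 0 :=
    ratPlusSymbol_zero_ne_zero_of_kuriharaVanishingOrder_eq_zero W 3 D.f hord
  refine deepLower_datum_of_plusSymbolEndShapeBound W htower D hord (M + t + 2) ?_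
  intro j' L n hj' hKL hcyc hLn ψ hψ hne hv
  haveI : NeZero n := ⟨hLn.ne_zero⟩
  have hL : L - M - 1 + M + 1 = L := by omega
  have hn' : Kato.IsKolyvaginProduct W 3 (L - M - 1 + M + 1) n := by rw [hL]; exact hLn
  exact padicValRat_ratPlusSymbol_le_of_towerSurj_deep_twoExp_unlocked_pinned hS24 hS24₂ hGZK hPT W t e M
    (L - M - 1) (by omega) htower D h0 v₃ hv₃ η hη hPort n hn' (fun ℓ _ hℓ => hcyc.2 ℓ hℓ)
    (fun ℓ hℓ hℓN => (hLn.2 ℓ hℓ).not_dvd_conductorNorm (hN ▸ hℓN)) (j := j') (by omega) ψ hψ hne hv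

end Summit.BirchSwinnertonDyer.BirchSwinnertonDyer.Theorems.KimAtThreeDeepLowerPortDeepTorsion

end
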